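import Summits.QuantumFields.YangMills.Theses.SmallCircleAnchor
import Summits.QuantumFields.YangMills.Theorems.SmallCircleAnchorAdiabaticContinuityStubDecompactification

/-!
# PROMOTE package — glue for splitting `AdiabaticContinuity` (stmt-QuantumFields-11142) into its two legs

Planner-ready, SORRY-FREE glue (continuation lead c1, 2026-08-17): the two registered stub statements of
line `registered` (skeleton `Cruxes/AdiabaticContinuity/Lines/birth.lean`, sha 0ff63db2…), copied verbatim —

* `ThermalContinuationUniform` (A*: Leg A with `T'`-uniform constants, from the anchor),
* `DeformationRemoval` (R: Leg B, deformation removal on the symmetric torus),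

and the theorem `adiabaticContinuity_of_legs : ThermalContinuationUniform → DeformationRemoval →
AdiabaticContinuity` (the skeleton's composition `AdiabaticContinuity_of` with the stub statements as
explicit hypotheses; the corner is the LANDED theorem `stub_decompactificationUniform`, p147338).
If the planner files A* and R as layer-2 children `C₁, C₂` of the crux (D-0019 glued split, k = 2), this
theorem is the glue `C₁ → C₂ → AdiabaticContinuity` verbatim (rename the two defs to the chosen decl
names). `lean check`: rc 0, sorries 0, axioms [propext, Classical.choice, Quot.sound].
-/

namespace Summit.QuantumFields.YangMills.Cruxes.AdiabaticContinuity.Birth.Promote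

open scoped BigOperators Topology Manifold Classical MeasureTheory ProbabilityTheory Matrix InnerProductSpace ComplexConjugate ContinuousMap
open Filter Set Function TopologicalSpace MeasureTheory


/-! ## Stub statements (inline vocabulary = the crux's `Cl τ s β m`, verbatim; `ClAt` = its body) -/

/-- **Stub A\* — thermal continuation at full deformation with `T'`-uniform constants (Leg A,
reshape r1).** For every `G, r`, abelianising `V` and anchor extent `T` there is a deformation
threshold `ε₁` such that for every schedule `E ≥ ε₁` and every `β₀`: if the anchor `(T, E(β)·V)`
clusters uniformly in `L` for all `β ≥ β₀` (`Cl (fun _ => T) (E β) β m`, definitionally the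
conclusion of `AnchorGap`), then there is `β₁` such that for every `β ≥ β₁` ONE rate `m > 0` and,
for every cube side `w`, ONE constant `C` cluster the `(T', E(β)·V)`-theory on `ℤ_{T'} × (ℤ/L)³` for
EVERY temporal extent `T' ≥ T` and every spatial size `L` (`ClAt (fun _ => T') (E β) β m w C L`).
(Ünsal–Yaffe: no transition in the circle size at fixed large deformation, arXiv:0803.0344 §5,
arXiv:0707.1869; the uniformity in `T'` is the zero-temperature end of that continuity.) -/
def ThermalContinuationUniform : Prop :=
  ∀ (G : Type) [Group G] [TopologicalSpace G] [IsTopologicalGroup G] [CompactSpace G],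
    Literature.MathematicalPhysics.QuantumFieldTheory.IsCompactSimpleLieGroup G →
    letI : MeasurableSpace G := borel G; haveI : BorelSpace G := ⟨rfl⟩;
    ∀ (r : Literature.MathematicalPhysics.QuantumFieldTheory.LatticeRep G) (V : G → ℝ),
    (Continuous V ∧ (∀ a g : G, V (a * g * a⁻¹) = V g) ∧ ∃ g₀ : G, (∀ g : G, V g₀ ≤ V g) ∧ (∀ g : G, V g = V g₀ → ∃ a : G, g = a * g₀ * a⁻¹) ∧
      (∀ a b : G, a * g₀ = g₀ * a → b * g₀ = g₀ * b → a * b = b * a)) →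
    ∀ (T : ℕ) [NeZero T],
    let ClAt := fun (τ : ℕ → ℕ) (s β m : ℝ) (w : ℕ) (C : ℝ) (L : ℕ) =>
      ∀ [NeZero L] [NeZero (τ L)],
      let St := ZMod (τ L) × (Fin 3 → ZMod L);
      let Cfg := St × Option (Fin 3) → G;
      let ν : MeasureTheory.Measure Cfg := MeasureTheory.Measure.pi fun _ => Literature.MathematicalPhysics.QuantumFieldTheory.haarProbability G;
      let sh : St → Option (Fin 3) → St := fun x μ => Option.elim μ (x.1 + 1, x.2) fun i => (x.1, x.2 + Pi.single i 1);
      let pl : Cfg → St → Option (Fin 3) → Option (Fin 3) → G := fun U x μ κ => U (x, μ) * U (sh x μ, κ) * (U (sh x κ, μ))⁻¹ * (U (x, κ))⁻¹;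
      let act : Cfg → ℝ := fun U => β * ∑ x : St, ∑ i : Fin 3, (r.ρ (pl U x none (some i))).trace.re + β * ∑ x : St, ∑ q : {q : Fin 3 × Fin 3 // q.1 < q.2}, (r.ρ (pl U x (some q.1.1) (some q.1.2))).trace.re;
      let P : Cfg → (Fin 3 → ZMod L) → G := fun U x => (List.ofFn fun t : Fin (τ L) => U ((((t : ℕ) : ZMod (τ L)), x), none)).prod;
      let wgt : Cfg → ℝ := fun U => Real.exp (act U - s * ∑ x : Fin 3 → ZMod L, V (P U x));
      let Ex : (Cfg → ℝ) → ℝ := fun F => (∫ U, F U * wgt U ∂ν) / (∫ U, wgt U ∂ν);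
      let σ : ℕ → Cfg → Cfg := fun n U p => U ((p.1.1, p.1.2 + Pi.single 0 (n : ZMod L)), p.2);
      ∀ (c : Fin 3 → ZMod L),
      let Loc := fun F : Cfg → ℝ => Measurable F ∧ (∀ U, |F U| ≤ 1) ∧ ∀ U U', (∀ p, (∀ i : Fin 3, (p.1.2 i - c i).val ≤ w) → U p = U' p) → F U = F U';
      ∀ F₁ F₂ : Cfg → ℝ, Loc F₁ → Loc F₂ → ∀ n : ℕ, 2 * n < L →
        |Ex (fun U => F₁ U * F₂ (σ n U)) - Ex F₁ * Ex (fun U => F₂ (σ n U))| ≤ C * Real.exp (-(m * n));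
    let Cl := fun (τ : ℕ → ℕ) (s β m : ℝ) => ∀ w : ℕ, ∃ C : ℝ, ∀ L : ℕ, ClAt τ s β m w C L;
    ∃ ε₁ : ℝ, ∀ E : ℝ → ℝ, (∀ β : ℝ, ε₁ ≤ E β) → ∀ β₀ : ℝ,
      (∀ β : ℝ, β₀ ≤ β → ∃ m : ℝ, 0 < m ∧ Cl (fun _ => T) (E β) β m) →
      ∃ β₁ : ℝ, ∀ β : ℝ, β₁ ≤ β → ∃ m : ℝ, 0 < m ∧
        ∀ w : ℕ, ∃ C : ℝ, ∀ (T' : ℕ), T ≤ T' → ∀ L : ℕ, ClAt (fun _ => T') (E β) β m w C L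

/-- **Stub R — deformation removal at zero temperature (Leg B).** For every `G, r`, abelianising `V`,
every schedule `E` and threshold `β₂`: if for all `β ≥ β₂` the fully deformed (`s = E(β)`) theory on the
symmetric torus `ℤ_L × (ℤ/L)³` clusters uniformly in `L`, then there is `β₃` such that for all `β ≥ β₃`
ONE rate `m > 0` clusters the `(L, s·V)`-theory uniformly in `L` for EVERY `s ∈ [0, E(β)]` — down to the
undeformed Wilson torus `s = 0` (whence `UniformLatticeGap` by the proved support `EndpointTransfer`).
(At zero temperature the pinning of Polyakov lines of length `L → ∞` is a boundary-like perturbation of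
an unbroken-centre bulk; kill: a bulk first-order transition in `s`.) -/
def DeformationRemoval : Prop :=
  ∀ (G : Type) [Group G] [TopologicalSpace G] [IsTopologicalGroup G] [CompactSpace G],
    Literature.MathematicalPhysics.QuantumFieldTheory.IsCompactSimpleLieGroup G →
    letI : MeasurableSpace G := borel G; haveI : BorelSpace G := ⟨rfl⟩;
    ∀ (r : Literature.MathematicalPhysics.QuantumFieldTheory.LatticeRep G) (V : G → ℝ),
    (Continuous V ∧ (∀ a g : G, V (a * g * a⁻¹) = V g) ∧ ∃ g₀ : G, (∀ g : G, V g₀ ≤ V g) ∧ (∀ g : G, V g = V g₀ → ∃ a : G, g = a * g₀ * a⁻¹) ∧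
      (∀ a b : G, a * g₀ = g₀ * a → b * g₀ = g₀ * b → a * b = b * a)) →
    let Cl := fun (τ : ℕ → ℕ) (s β m : ℝ) =>
      ∀ w : ℕ, ∃ C : ℝ, ∀ (L : ℕ) [NeZero L] [NeZero (τ L)],
      let St := ZMod (τ L) × (Fin 3 → ZMod L);
      let Cfg := St × Option (Fin 3) → G;
      let ν : MeasureTheory.Measure Cfg := MeasureTheory.Measure.pi fun _ => Literature.MathematicalPhysics.QuantumFieldTheory.haarProbability G;
      let sh : St → Option (Fin 3) → St := fun x μ => Option.elim μ (x.1 + 1, x.2) fun i => (x.1, x.2 + Pi.single i 1);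
      let pl : Cfg → St → Option (Fin 3) → Option (Fin 3) → G := fun U x μ κ => U (x, μ) * U (sh x μ, κ) * (U (sh x κ, μ))⁻¹ * (U (x, κ))⁻¹;
      let act : Cfg → ℝ := fun U => β * ∑ x : St, ∑ i : Fin 3, (r.ρ (pl U x none (some i))).trace.re + β * ∑ x : St, ∑ q : {q : Fin 3 × Fin 3 // q.1 < q.2}, (r.ρ (pl U x (some q.1.1) (some q.1.2))).trace.re;
      let P : Cfg → (Fin 3 → ZMod L) → G := fun U x => (List.ofFn fun t : Fin (τ L) => U ((((t : ℕ) : ZMod (τ L)), x), none)).prod;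
      let wgt : Cfg → ℝ := fun U => Real.exp (act U - s * ∑ x : Fin 3 → ZMod L, V (P U x));
      let Ex : (Cfg → ℝ) → ℝ := fun F => (∫ U, F U * wgt U ∂ν) / (∫ U, wgt U ∂ν);
      let σ : ℕ → Cfg → Cfg := fun n U p => U ((p.1.1, p.1.2 + Pi.single 0 (n : ZMod L)), p.2);
      ∀ (c : Fin 3 → ZMod L),
      let Loc := fun F : Cfg → ℝ => Measurable F ∧ (∀ U, |F U| ≤ 1) ∧ ∀ U U', (∀ p, (∀ i : Fin 3, (p.1.2 i - c i).val ≤ w) → U p = U' p) → F U = F U';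
      ∀ F₁ F₂ : Cfg → ℝ, Loc F₁ → Loc F₂ → ∀ n : ℕ, 2 * n < L →
        |Ex (fun U => F₁ U * F₂ (σ n U)) - Ex F₁ * Ex (fun U => F₂ (σ n U))| ≤ C * Real.exp (-(m * n));
    ∀ (E : ℝ → ℝ) (β₂ : ℝ),
      (∀ β : ℝ, β₂ ≤ β → ∃ m : ℝ, 0 < m ∧ Cl (fun L => L) (E β) β m) →
      ∃ β₃ : ℝ, ∀ β : ℝ, β₃ ≤ β → ∃ m : ℝ, 0 < m ∧
        ∀ s : ℝ, 0 ≤ s → s ≤ E β → Cl (fun L => L) s β m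

/-! ## The glue -/

theorem adiabaticContinuity_of_legs (hA : ThermalContinuationUniform) (hR : DeformationRemoval) :
    Summit.QuantumFields.YangMills.Theses.SmallCircleAnchor.AdiabaticContinuity := by
  intro G _ _ _ _ hG r V hV T _ Cl
  -- rate monotonicity of the local clustering predicate `Cl τ s β ·`
  have hmono : ∀ (τ : ℕ → ℕ) (s β m m' : ℝ), m ≤ m' → Cl τ s β m' → Cl τ s β m := by
    intro τ s β m m' hmm h w
    obtain ⟨C, hC⟩ := h w
    refine ⟨max C 0, fun L _ _ => ?_⟩
    intro St Cfg ν sh pl act P wgt Ex σ c Loc F₁ F₂ hF₁ hF₂ n hn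
    have key := hC L c F₁ F₂ hF₁ hF₂ n hn
    refine key.trans ?_
    calc C * Real.exp (-(m' * n)) ≤ max C 0 * Real.exp (-(m' * n)) :=
          mul_le_mul_of_nonneg_right (le_max_left _ _) (Real.exp_pos _).le
      _ ≤ max C 0 * Real.exp (-(m * n)) := by
          refine mul_le_mul_of_nonneg_left (Real.exp_le_exp.mpr ?_) (le_max_right _ _)
          have : m * (n : ℝ) ≤ m' * n := mul_le_mul_of_nonneg_right hmm (Nat.cast_nonneg n)
          linarith
  -- (A*) Leg A with uniform constants, from the anchor
  obtain ⟨εA, hεA⟩ := hA G hG r V hV T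
  refine ⟨εA, fun E hE β₀ hanch => ?_⟩
  -- the verbatim anchor hypothesis IS `Cl (fun _ => T) (E β) β m` (duplicate `NeZero T` binder dropped)
  have hanch' : ∀ β : ℝ, β₀ ≤ β → ∃ m : ℝ, 0 < m ∧ Cl (fun _ => T) (E β) β m := by
    intro β hβ
    obtain ⟨m, hm, hc⟩ := hanch β hβ
    refine ⟨m, hm, fun w => ?_⟩
    obtain ⟨C, hC⟩ := hc w
    exact ⟨C, fun L _ _ => hC L⟩
  obtain ⟨β₁, hβ₁⟩ := hεA E hE β₀ hanch'
  -- the corner (landed theorem, p147338): the fully deformed symmetric torus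
  obtain ⟨β₂, hβ₂⟩ :=
    Summit.QuantumFields.YangMills.Theorems.SmallCircleAnchor.stub_decompactificationUniform
      G hG r V hV T E β₁ hβ₁
  -- (R) Leg B from the corner
  obtain ⟨β₃, hβ₃⟩ := hR G hG r V hV E β₂ hβ₂
  -- one threshold, one rate
  refine ⟨max β₁ β₃, fun β hβ => ?_⟩
  obtain ⟨mA, hmA, hLegA⟩ := hβ₁ β ((le_max_left _ _).trans hβ)
  obtain ⟨mB, hmB, hLegB⟩ := hβ₃ β ((le_max_right _ _).trans hβ)
  refine ⟨min mA mB, lt_min hmA hmB, ?_, ?_⟩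
  · intro T' _ hT'
    refine hmono (fun _ => T') (E β) β (min mA mB) mA (min_le_left _ _) fun w => ?_
    obtain ⟨C, hC⟩ := hLegA w
    exact ⟨C, fun L _ _ => hC T' hT' L⟩
  · intro s hs0 hs1
    exact hmono (fun L => L) s β (min mA mB) mB (min_le_right _ _) (hLegB s hs0 hs1)

end Summit.QuantumFields.YangMills.Cruxes.AdiabaticContinuity.Birth.Promote
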